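import Summits.BirchSwinnertonDyer.BirchSwinnertonDyer.Theorems.UniversalToricDescentGoodLocalTermDecomp
import Summits.BirchSwinnertonDyer.BirchSwinnertonDyer.Theorems.UniversalToricDescentCoinvariantLocalCount
import Summits.BirchSwinnertonDyer.BirchSwinnertonDyer.Theorems.UniversalToricDescentMultiplicativeCoinvariants
import Summits.BirchSwinnertonDyer.BirchSwinnertonDyer.Theorems.ErratumRoadFiveSigmaLocalMultRank
import Literature.NumberTheory.EllipticCurves.SubgroupSelmerCocycleCriteriaProofs
import Literature.NumberTheory.EllipticCurves.PrimaryTorsionContinuousSMulProofs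
import HarnessLib

/-!
# Route UniversalToricDescent — Greenberg–Vatsal Prop. (2.4) at a MULTIPLICATIVE place `v ∤ p`, in closed
# form: `#H¹(kerD κ v, E[p^∞])[p] = p^{[p ∣ ε − q_v]}`

Lead prover bsd-wall-utd-p1 g9 (`--supports stmt-BirchSwinnertonDyer-20399`; the VALUE of the local term
`s_v` of 21845's algebraic half at the semistable bad places of the twin curve). For `E/K` with
multiplicative reduction at `v ∤ p` (`ε = 1` split, `ε = −1` non-split), `v` finitely decomposed in the
`ℤ_p`-extension `κ` (`D_v ⊄ ker κ`), `q_v = #k_v`: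

  **`#{f ∈ H¹(kerD κ v, E[p^∞]) : p • f = 0} = p` if `p ∣ ε − q_v`, and `= 1` otherwise**

(`natCard_pTorsion_subgroupH1_kerD_eq_pow_of_hasMultiplicativeReductionAt`), i.e. `s_v = 1` iff
`a_v = ε ≡ q_v (mod p)` — the multiplicity of the eigenvalue `q_v` in the Euler factor `1 − a_v q_v^{-1}X`,
as in Greenberg–Vatsal. Assembly of: the transport `kerD κ v ≅ ker κ ⊓ D_v ↔ Gal(K̄_v/K_{∞,w})`
(`UniversalToricDescentGoodLocalTermDecomp`, here for `E[p^∞]` in the `PrimaryTorsion` currency), the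
coinvariant local count (`UniversalToricDescentCoinvariantLocalCount`), the Literature evaluation
`H¹(I_v, E[p^∞]) ≃ E[p^∞]/D` at a tame `p`-generator, and `#(E[p^∞]/D)[p] = p`, `ρ̄(φ) = ε` on `E[p^∞]/D`
(`UniversalToricDescentMultiplicativeCoinvariants`, on top of the `bsd-stepL` (S5-mult) files).

THEOREMS ONLY; no definition, no named fact, no `sorry`. BSD is not advanced by this file.
References: [GreenbergVatsal2000] §2 Prop. (2.4) and proof (arXiv p. 22); [GreenbergLNM1716] §3 Lemma 3.3;
[SilvermanATAEC1994] Thm. V.5.3, Ex. 5.13.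
-/

set_option autoImplicit false
-- `…BirchSwinnertonDyer.BirchSwinnertonDyer.Theorems…` is the problem's mandated namespace (D-0017).
set_option linter.dupNamespace false

noncomputable section

open scoped Classical

namespace Summit.BirchSwinnertonDyer.BirchSwinnertonDyer.Theorems.UniversalToricDescentMultiplicativeLocalTerm

open Function NumberField IsDedekindDomain Field WeierstrassCurve ValuativeRel
open Literature.NumberTheory.EllipticCurves Literature.NumberTheory.EllipticCurves.GreenbergSelmer
  Literature.NumberTheory.GaloisRepresentations IsDedekindDomain.HeightOneSpectrum
  Literature.NumberTheory.EllipticCurves.BigGaloisRep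
  Literature.NumberTheory.GaloisRepresentations.IsNonarchimedeanLocalField
  Summit.BirchSwinnertonDyer.Rank1Residual.X11b Summit.BirchSwinnertonDyer.Rank1Residual.X11b.Coinv
  Summit.BirchSwinnertonDyer.Rank1Residual.Iwasawa
  Summit.BirchSwinnertonDyer.BirchSwinnertonDyer.Theorems.UniversalToricDescentSigmaPassage
  Summit.BirchSwinnertonDyer.BirchSwinnertonDyer.Theorems.UniversalToricDescentGoodLocalTerm
  Summit.BirchSwinnertonDyer.BirchSwinnertonDyer.Theorems.UniversalToricDescentGoodLocalTermTrichotomy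
  Summit.BirchSwinnertonDyer.BirchSwinnertonDyer.Theorems.UniversalToricDescentCoinvariantLocalCount
  Summit.BirchSwinnertonDyer.BirchSwinnertonDyer.Theorems.UniversalToricDescentMultiplicativeCoinvariants
  Summit.BirchSwinnertonDyer.BirchSwinnertonDyer.Theorems.SigmaLocal

/-! ### §1 Inflation along a surjection with a bijective coefficient map is injective on `H¹` -/

section Inflation

universe u

variable {G : Type u} [Group G] [TopologicalSpace G] [IsTopologicalGroup G]
  {G' : Type u} [Group G'] [TopologicalSpace G'] [IsTopologicalGroup G']
  {M : Type u} [AddCommGroup M] [DistribMulAction G M] [TopologicalSpace M] [DiscreteTopology M]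
  {N : Type u} [AddCommGroup N] [DistribMulAction G' N] [TopologicalSpace N] [DiscreteTopology N]

/-- `resH1Hom φ ψ : H¹(G, M) → H¹(G', N)` is injective when `φ : G' → G` is onto and `ψ : M → N` is a
compatible additive bijection (a coboundary `x ↦ x•n − n` of the pulled-back cocycle comes from the
coboundary of `ψ⁻¹ n`). [cite: SerreGaloisCohomology1997, I §2.4] -/
theorem resH1Hom_injective_of_surjective_of_bijective (φ : G' →ₜ* G) (hφ : Surjective φ) (ψ : M →+ N)
    (hψ : Bijective ψ) (h : ∀ (x : G') (m : M), ψ (φ x • m) = x • ψ m) :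
    Injective (resH1Hom φ ψ h) := by
  refine (injective_iff_map_eq_zero _).2 fun c hc ↦ ?_
  obtain ⟨f, rfl⟩ := oneCocycleClass_surjective _ c
  obtain ⟨n, hn⟩ := (CocycleCriteria.resH1Hom_oneCocycleClass_eq_zero_iff φ ψ h f).1 hc
  obtain ⟨m, rfl⟩ := hψ.2 n
  rw [oneCocycleClass_eq_zero_iff]
  refine ⟨m, fun g ↦ ?_⟩
  obtain ⟨x, rfl⟩ := hφ g
  apply hψ.1
  rw [hn x, ← h]
  show ψ (φ x • m) - ψ m = ψ (φ x • m - m)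
  rw [map_sub]

end Inflation

/-! ### §2 The local term at a multiplicative place -/

variable {K : Type} [Field K] [NumberField K] (W : WeierstrassCurve K) [W.IsElliptic] {p : ℕ}
  [Fact p.Prime] (κ : ZpExtension K p) {v : HeightOneSpectrum (𝓞 K)}

/-- **Transport `ker κ ⊓ D_v ↔ Gal(K̄_v/K_{∞,w})` for `E[p^∞]`**: at `v ∤ p` finitely decomposed in `K_∞`,
`#H¹(ker κ ⊓ D_v, E[p^∞])[p] = #H¹(Hi, E[p^∞])[p]`, where on the right `E[p^∞]` is the `PrimaryTorsion`
model with `Γ_{K_v}` acting through `absGaloisRestrict K K_v` and `Hi = localSubgroup (ker κ) K_v` (the two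
restrictions `Hi ↠ ker κ ⊓ D_v ↠ Hi` are onto, so both inflations are injective on `H¹`, and the
`p`-torsion groups are finite). [cite: GreenbergLNM1716, §3 Lemma 3.3] -/
theorem natCard_pTorsion_subgroupH1_inf_decomp_eq_localSubgroup (hpv : (p : 𝓞 K) ∉ v.asIdeal)
    (hD : ¬ (decomp v ≤ κ.kerSubgroup)) :
    letI : DistribMulAction (absoluteGaloisGroup (v.adicCompletion K)) (geomPoints W) :=
      DistribMulAction.compHom _ (absGaloisRestrict K (v.adicCompletion K)).toMonoidHom
    Nat.card {x : Literature.NumberTheory.EllipticCurves.subgroupH1 (κ.kerSubgroup ⊓ decomp v)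
        (W.geomPrimaryTorsion p) // p • x = 0} =
      Nat.card {f : Literature.NumberTheory.EllipticCurves.subgroupH1
        (localSubgroup κ.kerSubgroup (v.adicCompletion K)) (PrimaryTorsion (geomPoints W) p) // p • f = 0} := by
  letI : DistribMulAction (absoluteGaloisGroup (v.adicCompletion K)) (geomPoints W) :=
    DistribMulAction.compHom _ (absGaloisRestrict K (v.adicCompletion K)).toMonoidHom
  -- notation
  let Fv := v.adicCompletion K
  let G : Type := absoluteGaloisGroup Fv
  let Hi : Subgroup G := localSubgroup κ.kerSubgroup Fv
  let D : Subgroup (absoluteGaloisGroup K) := κ.kerSubgroup ⊓ decomp v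
  let A : Type := W.geomPrimaryTorsion p
  let A' : Type := PrimaryTorsion (geomPoints W) p
  haveI : CharZero Fv := charZero_of_injective_algebraMap (algebraMap K Fv).injective
  -- the two surjections `Hi ↠ D ↠ Hi` (as in `UniversalToricDescentGoodLocalTerm`)
  let θ₁ : Hi →ₜ* D :=
    { toFun := fun x ↦ ⟨absGaloisRestrict K Fv x, Subgroup.mem_inf.mpr ⟨by
          have h := (mem_localSubgroup_iff κ.kerSubgroup Fv x.1).mp x.2
          rwa [resGal_eq_absGaloisRestrict] at h, (mem_decomp_iff v _).mpr ⟨x, rfl⟩⟩⟩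
      map_one' := Subtype.ext (by simp)
      map_mul' := fun x y ↦ Subtype.ext (by simp)
      continuous_toFun :=
        ((absGaloisRestrict K Fv).continuous_toFun.comp continuous_subtype_val).subtype_mk _ }
  have hθ₁ : Surjective θ₁ := by
    rintro ⟨g, hg⟩
    obtain ⟨hgH, hgD⟩ := Subgroup.mem_inf.mp hg
    obtain ⟨σ, rfl⟩ := (mem_decomp_iff v g).mp hgD
    have hσ : σ ∈ Hi := by
      show σ ∈ localSubgroup κ.kerSubgroup Fv
      rw [mem_localSubgroup_iff, resGal_eq_absGaloisRestrict]; exact hgH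
    exact ⟨⟨σ, hσ⟩, rfl⟩
  let e := absGaloisRangeEquivCompletion K v
  have hDr : ∀ x : D, (x : absoluteGaloisGroup K) ∈ (absGaloisRestrict K Fv).range := fun x ↦
    (Subgroup.mem_inf.mp x.2).2
  have hmemHi : ∀ x : D, e.symm ⟨x.1, hDr x⟩ ∈ Hi := fun x ↦ by
    show e.symm ⟨x.1, hDr x⟩ ∈ localSubgroup κ.kerSubgroup Fv
    rw [mem_localSubgroup_iff, resGal_eq_absGaloisRestrict,
      absGaloisRestrict_absGaloisRangeEquivCompletion_symm]
    exact (Subgroup.mem_inf.mp x.2).1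
  let θ₂ : D →ₜ* Hi :=
    { toFun := fun x ↦ ⟨e.symm ⟨x.1, hDr x⟩, hmemHi x⟩
      map_one' := Subtype.ext (by
        show e.symm ⟨((1 : D) : absoluteGaloisGroup K), hDr 1⟩ = 1
        rw [← map_one e.symm]
        rfl)
      map_mul' := fun x y ↦ Subtype.ext (by
        show e.symm ⟨((x * y : D) : absoluteGaloisGroup K), hDr (x * y)⟩ =
          e.symm ⟨(x : absoluteGaloisGroup K), hDr x⟩ * e.symm ⟨(y : absoluteGaloisGroup K), hDr y⟩
        rw [← map_mul e.symm]
        rfl)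
      continuous_toFun :=
        (e.symm.continuous.comp (continuous_subtype_val.subtype_mk fun x ↦ hDr x)).subtype_mk
          fun x ↦ hmemHi x }
  have hθ₂res : ∀ x : D, absGaloisRestrict K Fv (θ₂ x : G) = (x : absoluteGaloisGroup K) := fun x ↦
    absGaloisRestrict_absGaloisRangeEquivCompletion_symm K v ⟨x.1, hDr x⟩
  have hθ₂ : Surjective θ₂ := fun y ↦ ⟨θ₁ y, Subtype.ext (by
    show e.symm ⟨absGaloisRestrict K Fv y, hDr (θ₁ y)⟩ = (y : G)
    have : (⟨absGaloisRestrict K Fv y, hDr (θ₁ y)⟩ : (absGaloisRestrict K Fv).range) = e y :=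
      Subtype.ext rfl
    rw [this, ContinuousMulEquiv.symm_apply_apply])⟩
  -- the identity `A ≃ A'` (the same subgroup of `E(K̄)`, two names)
  let ψ : A →+ A' := { toFun := fun a ↦ ⟨a.1, a.2⟩, map_zero' := rfl, map_add' := fun _ _ ↦ rfl }
  let ψ' : A' →+ A := { toFun := fun a ↦ ⟨a.1, a.2⟩, map_zero' := rfl, map_add' := fun _ _ ↦ rfl }
  have hψ : Bijective ψ := ⟨fun a b h ↦ Subtype.ext (congrArg Subtype.val h), fun a ↦ ⟨ψ' a, rfl⟩⟩
  have hψ' : Bijective ψ' := ⟨fun a b h ↦ Subtype.ext (congrArg Subtype.val h), fun a ↦ ⟨ψ a, rfl⟩⟩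
  -- the two injections
  let r₁ := resH1Hom θ₁ ψ fun x m ↦ (rfl : ψ (θ₁ x • m) = x • ψ m)
  have hr₁ : Injective r₁ := resH1Hom_injective_of_surjective_of_bijective θ₁ hθ₁ ψ hψ _
  let r₂ := resH1Hom θ₂ ψ' fun x m ↦ (by
    apply Subtype.ext
    show absGaloisRestrict K Fv (θ₂ x : G) • (m : geomPoints W) = (x : absoluteGaloisGroup K) • (m : geomPoints W)
    rw [hθ₂res] : ψ' (θ₂ x • m) = x • ψ' m)
  have hr₂ : Injective r₂ := resH1Hom_injective_of_surjective_of_bijective θ₂ hθ₂ ψ' hψ' _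
  haveI hfinD : Finite {x : Literature.NumberTheory.EllipticCurves.subgroupH1 D A // p • x = 0} :=
    (finite_pTorsion_subgroupH1_inf_decomp W κ hpv hD).to_subtype
  let g : {f : Literature.NumberTheory.EllipticCurves.subgroupH1 Hi A' // p • f = 0} →
      {x : Literature.NumberTheory.EllipticCurves.subgroupH1 D A // p • x = 0} :=
    fun f ↦ ⟨r₂ f.1, by rw [← map_nsmul, f.2, map_zero]⟩
  have hg : Injective g := fun a b h ↦ Subtype.ext (hr₂ (congrArg Subtype.val h))
  haveI : Finite {f : Literature.NumberTheory.EllipticCurves.subgroupH1 Hi A' // p • f = 0} :=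
    Finite.of_injective g hg
  exact natCard_eq_of_injective_of_injective
    (f := fun x ↦ ⟨r₁ x.1, by rw [← map_nsmul, x.2, map_zero]⟩) (g := g)
    (fun a b h ↦ Subtype.ext (hr₁ (congrArg Subtype.val h))) hg

/-- **Greenberg–Vatsal Prop. (2.4) at a place of MULTIPLICATIVE reduction, closed form.** For `E/K` with
multiplicative reduction at `v ∤ p` — `ε = 1` if split, `ε = −1` if non-split — and `v` finitely decomposed
in the `ℤ_p`-extension `κ` (`D_v ⊄ ker κ`):
**`#{f ∈ H¹(kerD κ v, E[p^∞]) : p • f = 0} = p^{s_v}` with `s_v = 1` if `p ∣ ε − q_v` and `s_v = 0`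
otherwise** (`q_v = #k_v`), i.e. `s_v` is the multiplicity of the eigenvalue `q_v` of Frobenius in the Euler
factor `1 − a_v q_v⁻¹ X`, `a_v = ε`. Chain: `kerD κ v ≅ ker κ ⊓ D_v ↔ Gal(K̄_v/K_{∞,w}) = Hi` on
`H¹(·, E[p^∞])[p]`; `H¹(Hi, A) ⥲ H¹(I_v, A)^{Hi}` (`Hi/I_v` pro-prime-to-`p`); `H¹(I_v, A) ≃ A/D`,
`D = (ρτ − 1)A = ⟨σa − a⟩` at a tame `p`-generator with Frobenius twist `q_v`; `Hi`-invariance ⟺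
`ρ̄(φ^{p^R}) x = q_v^{p^R} x`; `#(A/D)[p] = p`, `ρ̄(φ) = ε` on `A/D`; Fermat.
[cite: GreenbergVatsal2000, §2 Prop. (2.4) and proof (arXiv p. 22)] [cite: GreenbergLNM1716, §3 Lemma 3.3]
[cite: SilvermanATAEC1994, Thm. V.5.3, Ex. 5.13] -/
theorem natCard_pTorsion_subgroupH1_kerD_eq_pow_of_hasMultiplicativeReductionAt
    (hpv : (p : 𝓞 K) ∉ v.asIdeal) (hD : ¬ (decomp v ≤ κ.kerSubgroup))
    (hv : W.HasMultiplicativeReductionAt v) {ε : ℤ}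
    (hε : (W.HasSplitMultiplicativeReductionAt v ∧ ε = 1) ∨
      (¬ W.HasSplitMultiplicativeReductionAt v ∧ ε = -1)) :
    Nat.card {f : Literature.NumberTheory.EllipticCurves.subgroupH1 (kerD κ v)
        (W.geomPrimaryTorsion p) // p • f = 0} =
      p ^ (if (p : ℤ) ∣ ε - (Nat.card (IsLocalRing.ResidueField (v.adicCompletionIntegers K)) : ℤ)
        then 1 else 0) := by
  letI inst : DistribMulAction (absoluteGaloisGroup (v.adicCompletion K)) (geomPoints W) :=
    DistribMulAction.compHom _ (absGaloisRestrict K (v.adicCompletion K)).toMonoidHom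
  -- notation
  let Fv := v.adicCompletion K
  let G : Type := absoluteGaloisGroup Fv
  let Hi : Subgroup G := localSubgroup κ.kerSubgroup Fv
  let A' : Type := PrimaryTorsion (geomPoints W) p
  haveI : CharZero Fv := charZero_of_injective_algebraMap (algebraMap K Fv).injective
  haveI := absoluteGaloisGroup_compactSpace Fv
  have hp : p.Prime := Fact.out
  have hℓ : ringChar 𝓀[Fv] ≠ p := v.ringChar_residueField_adicCompletion_ne hpv
  -- `v` not split completely: some `σ ∈ Γ_{K_v}` restricts outside `ker κ`
  have hns : ∃ σ : G, σ ∉ Hi := by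
    by_contra hall
    refine hD fun g hg ↦ ?_
    obtain ⟨σ, rfl⟩ := (mem_decomp_iff v g).mp hg
    have hσ : σ ∈ Hi := not_not.mp fun h ↦ hall ⟨σ, h⟩
    have h := (mem_localSubgroup_iff κ.kerSubgroup Fv σ).mp hσ
    rwa [resGal_eq_absGaloisRestrict] at h
  -- the local representation on `E[p^∞]` and its hypotheses
  let ρ : ContinuousRep G ℤ_[p] A' := (W.primaryTorsionGaloisRep p).restrict (localMap K (Sum.inl v))
  have hρ : ∀ (g : G) (a : A'), ρ g a = g • a := fun _ _ ↦ rfl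
  haveI : ContinuousSMul ℤ_[p] A' := PrimaryTorsion.continuousSMul
  have hA : ∀ a : A', ∃ k : ℕ, p ^ k • a = 0 := primaryTorsion_exists_pow_nsmul_eq_zero W p
  have hfin : ∀ k : ℕ, Set.Finite {a : A' | p ^ k • a = 0} :=
    primaryTorsion_setOf_pow_nsmul_eq_zero_finite W p
  have hP : ∀ σ ∈ absInertia Fv, ∀ a : A', ∃ k : ℕ, ((ρ σ) ^ p ^ k) a = a := fun σ hσ a ↦
    exists_pow_prime_pow_apply_eq_of_mem_absInertia W p hpv hv hσ a
  -- a tame `p`-generator, the coinvariant evaluation, a Frobenius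
  obtain ⟨τ, hgen, -, hcoinv⟩ := exists_tame_generator_continuousCohomology_absInertia Fv (p := p) hℓ
  obtain ⟨e, he⟩ := hcoinv ρ hA hfin hP
  have hspan := range_sub_one_eq_span Fv ρ hA hfin hP hgen
  obtain ⟨φ, hφ⟩ := exists_isFrobPow_holds Fv 1
  -- `(A'/D)[p]` is finite
  let eQ := Submodule.quotEquivOfEq _ _ hspan
  have hfinS := quotient_setOf_pow_nsmul_eq_zero_finite W p (w := v) 1
  simp only [pow_one] at hfinS
  have hfinQ : Set.Finite {x : A' ⧸ LinearMap.range (ρ (τ : G) - 1) | p • x = 0} := by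
    refine (hfinS.preimage eQ.injective.injOn).subset fun x hx ↦ ?_
    show p • eQ x = 0
    rw [← map_nsmul, (hx : p • x = 0), map_zero]
  -- the coinvariant local count
  obtain ⟨R₀, hR₀⟩ := exists_forall_natCard_pTorsion_subgroupH1_localSubgroup_eq_coinvariants κ hpv hns
    ρ hρ hA hfin hP hgen e he hfinQ hφ
  rw [← natCard_pTorsion_subgroupH1_inf_decomp_eq_kerD W κ hpv hD,
    natCard_pTorsion_subgroupH1_inf_decomp_eq_localSubgroup W κ hpv hD, hR₀ R₀ le_rfl]
  -- transport to `A'/⟨σa − a⟩` and evaluate Frobenius as `ε`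
  have hfrob : ∀ x : A' ⧸ LinearMap.range (ρ (τ : G) - 1),
      eQ (Submodule.mapQ _ _ (ρ (φ ^ p ^ R₀))
        (range_sub_one_le_comap Fv ρ hA hfin hP hgen (φ ^ p ^ R₀)) x) = (ε ^ p ^ R₀) • eQ x := by
    intro x
    induction x using Submodule.Quotient.induction_on with | _ a => ?_
    rw [Submodule.mapQ_apply, Submodule.quotEquivOfEq_mk, Submodule.quotEquivOfEq_mk,
      ← ContinuousRep.quotient_apply_mk ρ _ (coinvSpan_le_comap W p),
      quotient_frob_pow_apply_eq_zsmul W p hpv hv hφ hε]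
  have key : Nat.card {x : A' ⧸ LinearMap.range (ρ (τ : G) - 1) // p • x = 0 ∧
      Submodule.mapQ _ _ (ρ (φ ^ p ^ R₀)) (range_sub_one_le_comap Fv ρ hA hfin hP hgen (φ ^ p ^ R₀)) x =
        (residueFieldCard Fv ^ p ^ R₀) • x} =
      Nat.card {y : A' ⧸ (Submodule.span ℤ_[p] {x : A' |
        ∃ σ ∈ absInertia Fv, ∃ a : A', x = ρ σ a - a}) // p • y = 0 ∧
          (ε ^ p ^ R₀) • y = (residueFieldCard Fv ^ p ^ R₀) • y} := by
    refine Nat.card_congr (eQ.toEquiv.subtypeEquiv fun x ↦ ?_)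
    show p • x = 0 ∧ _ ↔ p • eQ x = 0 ∧ (ε ^ p ^ R₀) • eQ x = (residueFieldCard Fv ^ p ^ R₀) • eQ x
    rw [← hfrob, ← map_nsmul eQ, ← map_nsmul eQ, eQ.injective.eq_iff, map_eq_zero_iff _ eQ.injective]
  rw [key, natCard_pTorsion_zsmul_eq_nsmul (natCard_pTorsion_quotient_coinvSpan_eq W p hpv hv)
    (ε ^ p ^ R₀) (residueFieldCard Fv ^ p ^ R₀)]
  have hiff : ((p : ℤ) ∣ ε ^ p ^ R₀ - ((residueFieldCard Fv ^ p ^ R₀ : ℕ) : ℤ)) ↔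
      ((p : ℤ) ∣ ε - (Nat.card (IsLocalRing.ResidueField (v.adicCompletionIntegers K)) : ℤ)) := by
    rw [Nat.cast_pow, prime_dvd_pow_prime_pow_sub_iff, residueFieldCard_eq_natCard_residueField]
  by_cases h : (p : ℤ) ∣ ε - (Nat.card (IsLocalRing.ResidueField (v.adicCompletionIntegers K)) : ℤ)
  · rw [if_pos (hiff.mpr h), if_pos h, pow_one]
  · rw [if_neg (fun h' ↦ h (hiff.mp h')), if_neg h, pow_zero]

end Summit.BirchSwinnertonDyer.BirchSwinnertonDyer.Theorems.UniversalToricDescentMultiplicativeLocalTerm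

end
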